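/-
Copyright: statement-level skeleton of a published paper (lit-balaban cell, Phase-2 proof seat p13, gen 11). No proof
claims beyond what the kernel checks below.
-/
import Literature.MathematicalPhysics.QuantumFieldTheory.BalabanImbrieJaffe1984to88.BIJ88Ineq576Proof

/-!
# `BalabanImbrieJaffe1984to88.BIJ88ProductLocalized292` — T. Bałaban, J. Imbrie, A. Jaffe, *Effective action and cluster
properties of the abelian Higgs model*, Commun. Math. Phys. **114** (1988) 257–315 [BalabanImbrieJaffe1988]: Sect. 5.7,
p. 292 — THE LOCALIZED EXPANSION OF A PRODUCT OF SCALE-LOCALIZED FIELDS.  The print, verbatim (p. 292 [PDF 36], after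
(5.7.10)):

*"We write all terms in the form of the expansions derived in this section, except that we write a new expansion analogous to
one we gave above for (w₅A′)^m_b:  Π_{α∈α̲} (θ_{j_α}(1 − θ_{j_α+1})w₅A′)_b = Σ_X w_{b,α̲}(X).  Here α̲ ⊂ {1, …, n}, and w_{b,α̲}(X) is
also bounded as in (5.7.6)."*

The expansion *"we gave above"* is (5.7.5) p. 289, *"(w₅A′)^m_b = Σ_X w_{b,m}(X), w_{b,m}(X) = Σ_{(b₁…b_m) compatible with b,X}
Π_{l=1}^m (w₅(b,b_l)A′(b_l))"* (r16's `BIJ88Sect5StatementsPart4.wbm`, identity `eq575`), and (5.7.6) p. 290 is *"|w_{b,m}(X)| ≦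
e^{−cr(e_k)|X|}"* (r16's leaf `BIJ88Sect5StatementsPart2.Ineq576`, discharged on `ℤ^d` by p36's `BIJ88Ineq576Proof.ineq576_Zd`).
The factors here are the scale-localized fields `Ã̃_{j_α} = θ_{j_α}(1 − θ_{j_α+1})w₅A′` of p. 291/292 (*"each Ã̃_j is a smooth,
small field supported in Λ̄₅^{(j)} ∩ Λ̄₆^{(j+1)c}"*), the cutoffs acting on the field `w₅A′` pointwise in the bond `b` — the
reading of record of r16's telescoping `BIJ88Sect5StatementsPart4.telescope5710`/`eq5710_split` (values in a commutative
ring).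

statement-level skeleton of published theorems with citation tags; proofs where landed; nothing here is a claim about the Yang–Mills mass gap

PDF held: `paper:balaban1988-cmp114-bij-abelian-higgs-effective-action` (journal page = PDF page + 256); p. 292 [PDF 36]
read as IMAGE (CCITT render; copy `HOME/lit-balaban-p13/pages/original-p036-x2.png`), pp. 289–290 [PDF 33–34] likewise.

CITATION HEADER (lean-in-tree rule).  Part of the lit-balaban TYPED SKELETON (HOME `run/shared/lean/pub/lit-balaban/`):
WHAT IS REPRODUCED = row **C2.Eq5.7.10-5.7.12** of `HOME/lit-balaban-r16/ROWS-C2-part2.md` (E-row, pp. 291–294), member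
*p. 292, the unnumbered display `Π_{α∈α̲}(θ_{j_α}(1−θ_{j_α+1})w₅A′)_b = Σ_X w_{b,α̲}(X)` with its bound*.  Unit
`lit-balaban-p13` (gen 11), owner r16, referee ref-5.  Built BY NAME on r16's `wbm`/`eq575` ((5.7.5)),
`Ineq576` ((5.7.6)), `PolymerSys`, and p36's `ineq576_Zd` with its `ℤ^d` association `BIJ88Assoc575Zd.assocZd` and
`BIJ88WalkGeometryZd.supDist`; nothing restated.

## What is kernel-checked here

* §1 THE GENERAL PRODUCT (rows allowed to differ per factor — covers also a reading with the cutoffs inside the kernel):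
  `wFam rows A′ assoc X = Σ_{(b₁…b_m) associated to X} Π_l rows_l(b_l)A′(b_l)` (definition with body);
  **`prod_rows_eq_sum_wFam`** — `Π_l (Σ_{b′} rows_l(b′)A′(b′)) = Σ_X wFam rows A′ assoc X` (multinomial expansion + fibrewise
  regrouping over the association, exactly as (5.7.5)); `wFam_const_rows` — equal rows give back r16's `w_{b,m}(X)`;
  **`abs_wFam_le_wbm_abs`** — rows dominated by `|w₅(b,·)|` give `|wFam(X)| ≤ w̄_{b,m}(X)`, the (5.7.5)-piece of the absolute
  kernel `|w₅|` and field `|A′|`; hence **`ineq576_wFam`**: any (5.7.6)-bound for the absolute pieces is inherited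
  (*"w_{b,α̲}(X) is also bounded as in (5.7.6)"*), and **`ineq576_wFam_Zd`**: on `ℤ^d` the bound holds outright under p36's
  printed hypotheses (`|w₅(b,b′)| ≤ e^{−c₁r}e^{−c₂dist}`, `|A′| ≤ a`, `r(e_k)` large).
* §2 THE PRINTED DISPLAY (cutoff factors `θ_{j_α}(b)(1 − θ_{j_α+1}(b)) ∈ [0,1]` at the bond `b`): **`display292`** —
  `Π_{α∈α̲} (θ_{j_α}(b)(1−θ_{j_α+1}(b))·(w₅A′)_b) = Σ_X w_{b,α̲}(X)` with **`wAlpha`** `= (Π_{α∈α̲} θ_{j_α}(b)(1−θ_{j_α+1}(b)))·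
  w_{b,|α̲|}(X)` (definition with body); **`abs_wAlpha_le`** (`|w_{b,α̲}(X)| ≤ |w_{b,|α̲|}(X)|` for cutoffs with values in
  `[0,1]`), **`ineq576_wAlpha`** (*"also bounded as in (5.7.6)"*: inherits r16's `Ineq576` from `w_{b,|α̲|}`), and
  **`ineq576_wAlpha_Zd`** (the `ℤ^d` instance of record, hypotheses as in p36's `ineq576_Zd`, `α̲ ≠ ∅`).

HONEST SCOPE.  Finite-volume algebra and the domination argument only; `w₅`, `A′`, the cutoffs `θ_j` and the association are
INPUTS; the supports of the `θ_j` (the regions `Λ̄₅^{(j)} ∩ Λ̄₆^{(j+1)c}`) play no role in the identity or the bound and are not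
modelled.  Definitions with bodies (`wFam`, `wAlpha`) + theorems; no `Prop` facts; axioms standard.
-/

noncomputable section

open scoped BigOperators
open Finset

namespace Literature.MathematicalPhysics.QuantumFieldTheory.BalabanImbrieJaffe1984to88.BIJ88ProductLocalized292

open BIJ88Sect5StatementsPart2 (PolymerSys Ineq576)
open BIJ88Sect5StatementsPart4 (wbm eq575 pow_applyKernel_eq_sum_tuples)
open BIJ88Assoc575Zd (assocZd)
open BIJ88WalkGeometryZd (supDist)
open BIJ88Ineq576Proof (ineq576_Zd)

/-! ## §1 The localized expansion of a product of (possibly different) kernel rows -/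

section Family

variable {β ξ : Type*} [Fintype β] [DecidableEq ξ] {m : ℕ}

/-- The localized pieces of a PRODUCT of `m` fields `(rows_l A′)_b = Σ_{b′} rows_l(b′)A′(b′)` with possibly different kernel
rows: `wFam(X) = Σ_{(b₁…b_m) associated to X} Π_l rows_l(b_l)A′(b_l)` — the `w_{b,α̲}(X)` of p. 292 in the general reading
(for equal rows `rows_l = w₅(b,·)` it is r16's `w_{b,m}(X)` of (5.7.5), `wFam_const_rows`).
[cite: BalabanImbrieJaffe1988, (5.7.5) p.289, p.292] -/
def wFam (rows : Fin m → β → ℝ) (A' : β → ℝ) (assoc : (Fin m → β) → ξ) (X : ξ) : ℝ :=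
  ∑ t ∈ (Finset.univ : Finset (Fin m → β)).filter (fun t => assoc t = X), ∏ l, rows l (t l) * A' (t l)

/-- multinomial expansion of a product of `m` rows: `Π_l (Σ_{b′} rows_l(b′)A′(b′)) = Σ_{(b₁…b_m)} Π_l rows_l(b_l)A′(b_l)`.
[cite: BalabanImbrieJaffe1988, (5.7.5) p.289, p.292] -/
theorem prod_rows_eq_sum_tuples (rows : Fin m → β → ℝ) (A' : β → ℝ) :
    ∏ l, (∑ b', rows l b' * A' b') = ∑ t : Fin m → β, ∏ l, rows l (t l) * A' (t l) :=
  Fintype.prod_sum fun l b' => rows l b' * A' b'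

/-- **THE PRODUCT EXPANSION** (p. 292, general rows): `Π_l (rows_l A′)_b = Σ_X wFam(X)`, the `X`-sum over any finite set
of polymers containing the range of the association (fibrewise regrouping, as (5.7.5)).
[cite: BalabanImbrieJaffe1988, (5.7.5) p.289, p.292] -/
theorem prod_rows_eq_sum_wFam_of_maps_to (rows : Fin m → β → ℝ) (A' : β → ℝ) (assoc : (Fin m → β) → ξ)
    (Xs : Finset ξ) (hXs : ∀ t, assoc t ∈ Xs) :
    ∏ l, (∑ b', rows l b' * A' b') = ∑ X ∈ Xs, wFam rows A' assoc X := by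
  rw [prod_rows_eq_sum_tuples]
  unfold wFam
  exact (Finset.sum_fiberwise_of_maps_to (fun t _ => hXs t) _).symm

/-- the same over all polymers of a finite polymer type. [cite: BalabanImbrieJaffe1988, (5.7.5) p.289, p.292] -/
theorem prod_rows_eq_sum_wFam [Fintype ξ] (rows : Fin m → β → ℝ) (A' : β → ℝ) (assoc : (Fin m → β) → ξ) :
    ∏ l, (∑ b', rows l b' * A' b') = ∑ X, wFam rows A' assoc X :=
  prod_rows_eq_sum_wFam_of_maps_to rows A' assoc Finset.univ fun _ => Finset.mem_univ _

/-- equal rows `rows_l = w(b,·)`: `wFam` IS r16's `w_{b,m}(X)` of (5.7.5) (definitional).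
[cite: BalabanImbrieJaffe1988, (5.7.5) p.289] -/
theorem wFam_const_rows (w : β → β → ℝ) (A' : β → ℝ) (b : β) (assoc : (Fin m → β) → ξ) (X : ξ) :
    wFam (fun _ => w b) A' assoc X = wbm w A' b m assoc X := rfl

/-- **DOMINATION**: if every row is dominated by the absolute row of `w₅` at `b`, `|rows_l(b′)| ≤ |w₅(b,b′)|` (e.g. rows
`θ·w₅(b,·)` with a cutoff `θ ∈ [0,1]` placed anywhere), then `|wFam(X)| ≤ w̄_{b,m}(X)`, the (5.7.5)-piece of the absolute
kernel `|w₅|` and the absolute field `|A′|` (a sum of non-negative terms over the same fibre).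
[cite: BalabanImbrieJaffe1988, (5.7.6) p.290, p.292] -/
theorem abs_wFam_le_wbm_abs (rows : Fin m → β → ℝ) (A' : β → ℝ) (w : β → β → ℝ) (b : β)
    (assoc : (Fin m → β) → ξ) (hdom : ∀ l b', |rows l b'| ≤ |w b b'|) (X : ξ) :
    |wFam rows A' assoc X| ≤ wbm (fun b₁ b₂ => |w b₁ b₂|) (fun b' => |A' b'|) b m assoc X := by
  unfold wFam wbm
  refine (Finset.abs_sum_le_sum_abs _ _).trans (Finset.sum_le_sum fun t _ => ?_)
  rw [Finset.abs_prod]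
  refine Finset.prod_le_prod (fun l _ => abs_nonneg _) fun l _ => ?_
  rw [abs_mul]
  exact mul_le_mul_of_nonneg_right (hdom l (t l)) (abs_nonneg _)

/-- *"w_{b,α̲}(X) is also bounded as in (5.7.6)"* (general rows): a (5.7.6)-bound `Ineq576` for the absolute pieces
`w̄_{b,m}` is inherited by `wFam` under domination. [cite: BalabanImbrieJaffe1988, (5.7.6) p.290, p.292] -/
theorem ineq576_wFam (P : PolymerSys) [DecidableEq P.Poly] (rows : Fin m → β → ℝ) (A' : β → ℝ) (w : β → β → ℝ)
    (b : β) (assoc : (Fin m → β) → P.Poly) (hdom : ∀ l b', |rows l b'| ≤ |w b b'|) {c rk : ℝ}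
    (h : Ineq576 P (wbm (fun b₁ b₂ => |w b₁ b₂|) (fun b' => |A' b'|) b m assoc) c rk) :
    Ineq576 P (wFam rows A' assoc) c rk := fun X =>
  (abs_wFam_le_wbm_abs rows A' w b assoc hdom X).trans ((le_abs_self _).trans (h X))

/-- **(5.7.6) for the product pieces on `ℤ^d`, hypotheses as printed** (p36's `ineq576_Zd` applied to the absolute kernel
and field, whose hypotheses are the same): bonds placed in `ℤ^d` by `pos` with at most `N` per site, cubes of side `ℓ ≥ 1`,
`m ≥ 1` factors with rows dominated by `|w₅(b,·)|`, `|w₅(b,b′)| ≤ e^{−c₁ℓ}e^{−c₂dist(b,b′)}`, `|A′(b′)| ≤ a`, and `r(e_k)` large: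
then `|wFam(X)| ≤ e^{−c′ℓ|X|}` for all polymers `X`, `c′ = min(c₁/4, min(c₁/2,c₂)/(2d))`.
[cite: BalabanImbrieJaffe1988, (5.7.6) p.290, p.292] -/
theorem ineq576_wFam_Zd {dd : ℕ} [DecidableEq β] (hd : 0 < dd) (pos : β → Fin dd → ℤ) (N : ℕ)
    (hN : ∀ y, (Finset.univ.filter fun b' => pos b' = y).card ≤ N) {ℓ : ℕ} (hℓ : 0 < ℓ) (rows : Fin m → β → ℝ)
    (w : β → β → ℝ) (A' : β → ℝ) (b : β) (hm : 1 ≤ m) (hdom : ∀ l b', |rows l b'| ≤ |w b b'|) {c₁ c₂ a : ℝ}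
    (hc₁ : 0 < c₁) (hc₂ : 0 < c₂)
    (hw : ∀ b', |w b b'| ≤ Real.exp (-(c₁ * ℓ)) * Real.exp (-(c₂ * supDist (pos b) (pos b'))))
    (hA : ∀ b', |A' b'| ≤ a)
    (hlarge : a * (N * (1 + 4 * dd / min (c₁ / 2) c₂) ^ dd) ≤ Real.exp (c₁ * ℓ / 4)) :
    Ineq576 ⟨Finset (Fin dd → ℤ), Finset.card⟩ (wFam rows A' (assocZd pos ℓ b m))
      (min (c₁ / 4) (min (c₁ / 2) c₂ / (2 * dd))) ℓ := by
  classical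
  refine ineq576_wFam ⟨Finset (Fin dd → ℤ), Finset.card⟩ rows A' w b (assocZd pos ℓ b m) hdom ?_
  refine ineq576_Zd hd pos N hN hℓ (fun b₁ b₂ => |w b₁ b₂|) (fun b' => |A' b'|) b hm hc₁ hc₂ ?_ ?_ hlarge
  · intro b'; rw [abs_abs]; exact hw b'
  · intro b'; rw [abs_abs]; exact hA b'

end Family

/-! ## §2 The printed display: cutoff factors `θ_{j_α}(b)(1 − θ_{j_α+1}(b))` at the bond `b` -/

section Printed

variable {β ξ : Type*} [Fintype β] [DecidableEq ξ]

/-- **`w_{b,α̲}(X)`** of p. 292: for the index set `α̲` (a finite set of labels `α` with scales `j_α`), cutoffs `θ_i` (functions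
of the bond) and the (5.7.5)-pieces of `w₅A′` at `b`:
`w_{b,α̲}(X) = (Π_{α∈α̲} θ_{j_α}(b)(1 − θ_{j_α+1}(b))) · w_{b,|α̲|}(X)`. [cite: BalabanImbrieJaffe1988, p.292] -/
def wAlpha (s : Finset ℕ) (j : ℕ → ℕ) (θ : ℕ → β → ℝ) (w : β → β → ℝ) (A' : β → ℝ) (b : β)
    (assoc : (Fin s.card → β) → ξ) (X : ξ) : ℝ :=
  (∏ α ∈ s, θ (j α) b * (1 - θ (j α + 1) b)) * wbm w A' b s.card assoc X

/-- **THE p. 292 DISPLAY PROVED**: *"Π_{α∈α̲} (θ_{j_α}(1 − θ_{j_α+1})w₅A′)_b = Σ_X w_{b,α̲}(X)"* — at a fixed bond `b` each factor is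
the scalar `θ_{j_α}(b)(1 − θ_{j_α+1}(b))` times `(w₅A′)_b = Σ_{b′} w₅(b,b′)A′(b′)`, so the product is `(Π_α θ…)·((w₅A′)_b)^{|α̲|}`
and (5.7.5) with `m = |α̲|` localizes it; the `X`-sum over all polymers of a finite polymer type.
[cite: BalabanImbrieJaffe1988, (5.7.5) p.289, p.292] -/
theorem display292 [DecidableEq β] [Fintype ξ] (s : Finset ℕ) (j : ℕ → ℕ) (θ : ℕ → β → ℝ) (w : β → β → ℝ) (A' : β → ℝ) (b : β)
    (assoc : (Fin s.card → β) → ξ) :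
    ∏ α ∈ s, (θ (j α) b * (1 - θ (j α + 1) b) * ∑ b', w b b' * A' b') = ∑ X, wAlpha s j θ w A' b assoc X := by
  unfold wAlpha
  rw [Finset.prod_mul_distrib, Finset.prod_const, eq575 w A' b s.card assoc, Finset.mul_sum]

omit [Fintype β] in
/-- cutoffs with values in `[0,1]` give a prefactor in `[0,1]`. [cite: BalabanImbrieJaffe1988, p.292] -/
theorem prefactor_mem_unitInterval (s : Finset ℕ) (j : ℕ → ℕ) (θ : ℕ → β → ℝ) (b : β)
    (hθ : ∀ i, 0 ≤ θ i b ∧ θ i b ≤ 1) :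
    0 ≤ ∏ α ∈ s, θ (j α) b * (1 - θ (j α + 1) b) ∧ ∏ α ∈ s, θ (j α) b * (1 - θ (j α + 1) b) ≤ 1 := by
  refine ⟨Finset.prod_nonneg fun α _ => mul_nonneg (hθ _).1 (by linarith [(hθ (j α + 1)).2]),
    Finset.prod_le_one (fun α _ => mul_nonneg (hθ _).1 (by linarith [(hθ (j α + 1)).2])) fun α _ => ?_⟩
  have h1 := hθ (j α)
  have h2 := hθ (j α + 1)
  nlinarith

/-- **`|w_{b,α̲}(X)| ≤ |w_{b,|α̲|}(X)|`** for cutoffs with values in `[0,1]`. [cite: BalabanImbrieJaffe1988, (5.7.6) p.290, p.292] -/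
theorem abs_wAlpha_le (s : Finset ℕ) (j : ℕ → ℕ) (θ : ℕ → β → ℝ) (w : β → β → ℝ) (A' : β → ℝ) (b : β)
    (assoc : (Fin s.card → β) → ξ) (hθ : ∀ i, 0 ≤ θ i b ∧ θ i b ≤ 1) (X : ξ) :
    |wAlpha s j θ w A' b assoc X| ≤ |wbm w A' b s.card assoc X| := by
  obtain ⟨h0, h1⟩ := prefactor_mem_unitInterval s j θ b hθ
  unfold wAlpha
  rw [abs_mul, abs_of_nonneg h0]
  exact mul_le_of_le_one_left (abs_nonneg _) h1

/-- *"w_{b,α̲}(X) is also bounded as in (5.7.6)"*: r16's (5.7.6) leaf `Ineq576` for `w_{b,|α̲|}` is inherited by `w_{b,α̲}`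
(cutoffs with values in `[0,1]`). [cite: BalabanImbrieJaffe1988, (5.7.6) p.290, p.292] -/
theorem ineq576_wAlpha (P : PolymerSys) [DecidableEq P.Poly] (s : Finset ℕ) (j : ℕ → ℕ) (θ : ℕ → β → ℝ)
    (w : β → β → ℝ) (A' : β → ℝ) (b : β) (assoc : (Fin s.card → β) → P.Poly) (hθ : ∀ i, 0 ≤ θ i b ∧ θ i b ≤ 1)
    {c rk : ℝ} (h : Ineq576 P (wbm w A' b s.card assoc) c rk) :
    Ineq576 P (wAlpha s j θ w A' b assoc) c rk := fun X =>
  (abs_wAlpha_le s j θ w A' b assoc hθ X).trans (h X)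

/-- **(5.7.6) for `w_{b,α̲}` on `ℤ^d`, hypotheses as printed** (`α̲ ≠ ∅`; p36's `ineq576_Zd`): bonds placed in `ℤ^d` by `pos`
with at most `N` per site, cubes of side `ℓ ≥ 1`, `|w₅(b,b′)| ≤ e^{−c₁ℓ}e^{−c₂dist(b,b′)}`, `|A′(b′)| ≤ a`, `r(e_k)` large, cutoffs
with values in `[0,1]`: `|w_{b,α̲}(X)| ≤ e^{−c′ℓ|X|}` for all `X`, `c′ = min(c₁/4, min(c₁/2,c₂)/(2d))`.
[cite: BalabanImbrieJaffe1988, (5.7.6) p.290, p.292] -/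
theorem ineq576_wAlpha_Zd [DecidableEq β] {dd : ℕ} (hd : 0 < dd) (pos : β → Fin dd → ℤ) (N : ℕ)
    (hN : ∀ y, (Finset.univ.filter fun b' => pos b' = y).card ≤ N) {ℓ : ℕ} (hℓ : 0 < ℓ) (s : Finset ℕ)
    (hs : s.Nonempty) (j : ℕ → ℕ) (θ : ℕ → β → ℝ) (w : β → β → ℝ) (A' : β → ℝ) (b : β)
    (hθ : ∀ i, 0 ≤ θ i b ∧ θ i b ≤ 1) {c₁ c₂ a : ℝ} (hc₁ : 0 < c₁) (hc₂ : 0 < c₂)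
    (hw : ∀ b', |w b b'| ≤ Real.exp (-(c₁ * ℓ)) * Real.exp (-(c₂ * supDist (pos b) (pos b'))))
    (hA : ∀ b', |A' b'| ≤ a)
    (hlarge : a * (N * (1 + 4 * dd / min (c₁ / 2) c₂) ^ dd) ≤ Real.exp (c₁ * ℓ / 4)) :
    Ineq576 ⟨Finset (Fin dd → ℤ), Finset.card⟩ (wAlpha s j θ w A' b (assocZd pos ℓ b s.card))
      (min (c₁ / 4) (min (c₁ / 2) c₂ / (2 * dd))) ℓ := by
  classical
  exact ineq576_wAlpha ⟨Finset (Fin dd → ℤ), Finset.card⟩ s j θ w A' b (assocZd pos ℓ b s.card) hθ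
    (ineq576_Zd hd pos N hN hℓ w A' b (Finset.card_pos.mpr hs) hc₁ hc₂ hw hA hlarge)

end Printed

end Literature.MathematicalPhysics.QuantumFieldTheory.BalabanImbrieJaffe1984to88.BIJ88ProductLocalized292
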